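import Literature.NumberTheory.Rogawski1990.ArchCentralLimitCornerRegularity        -- ★ def p843483 `ArchCentralLimitCornerRegularity` ((A6): the corner-extension socket)
import Literature.NumberTheory.Automorphic.ArchLocalRelabelTransport                 -- ★ (F0P3a-p07 (g7)): `e_σ : G_w(α∘σ) ≃ₜ* G_w(α)`, Haar ∕ test-function ∕ orbital-integral transport
import Literature.NumberTheory.Automorphic.ArchLocalDiagonalOppositeSignFrame        -- ★ (G′-a) `exists_continuousMulEquiv_archLocal_of_oppositeSigns`; brings ★ (G) `ArchLocalDiagonalSignFrame`
import Literature.NumberTheory.Automorphic.ArchLocalRegularOrbitClosed               -- ★ `locallyCompactSpace_archLocal`, `secondCountableTopology_archLocal`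
import HarnessLib

/-!
# (A6) CORNER REGULARITY IS FRAME BOOKKEEPING-INVARIANT: relabelling the diagonal frame (`α ↦ α ∘ σ`) and flipping its sign pattern (`U(−H) = U(H)`)
# (Rogawski 1990 §8.4 p. 126 — the statement is about the group `U(2,1)` ∕ `U(3)`, not about how the diagonal form is written)

Topic `NumberTheory/Rogawski1990`; namespace `Literature.NumberTheory.Rogawski1990`.  THEOREMS ONLY (no `def`, no instance, no notation, no axiom, no named fact, no `sorry`).
Cell `pub/hodgecm-mathlib`, ENGINE T1 (crux H413 = `stmt-HodgeConjecture-24833`); companion of ★ `ArchCentralLimitFormulaOfPerm` (FILE A, the LETTER's relabelling transport) and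
★ `ArchCentralLimitFormulaOfOppositeSigns` ((G′), the LETTER's sign transport) for the (A6) socket ★ def `ArchCentralLimitCornerRegularity` (p843483); F0P3a-p09 (g3), 2026-09-01.
Purpose: the sequel `ArchCentralLimitCornerRegularityHolds` discharges (A6) at EVERY frame from ★ `archCentralLimitCornerRegularity_of_signs` (p847160: the e-pattern frames) + these transports
+ the definite frames.

WHAT IS PROVED.
* §1 **`rhoWeylDelta_angle_comp_perm`** — the letter's prefactor `P(z) = z₀z₂⁻¹(1 − z₁z₀⁻¹)(1 − z₂z₁⁻¹)(1 − z₂z₀⁻¹)` (`ρ′Δ` in the angle chart, `z_k = ζe^{iθ_k}`) is ALTERNATING: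
  `P(z ∘ σ) = sign(σ)·P(z)` for `z_k ≠ 0` (it equals `−∏_{i<j} 2i·sin((θ_j − θ_i)∕2)`; proof: the three transpositions by `field_simp; ring`, then `Perm.swap_induction_on`).
* §2 **`archCentralLimitCornerRegularity_of_perm (σ) : ArchCentralLimitCornerRegularity L (α ∘ σ) w → ArchCentralLimitCornerRegularity L α w`** — relabelling iso `e_σ` (★
  `ArchLocalRelabelTransport`: Haar pulled back, `Θ ↦ Θ ∘ Ad M(σ)`, `Φ^α_Θ(ζe^{iθ}) = Φ^{α∘σ}_{Θ_σ}(ζe^{i(θ∘σ)})` by ★ `integral_comp_conj_circleDiagonal_comp_perm_eq_integral_ambient`);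
  the corner extension on the chamber `τ` at `α` is `H(θ) = sign(σ)·H′(θ ∘ σ)` where `H′` is the extension on the chamber `σ⁻¹τ` at `α ∘ σ` (§1: `ρ′Δ(θ∘σ) = sign(σ)·ρ′Δ(θ)`).
* §3 **`archCentralLimitCornerRegularity_of_frame`** — along a torus-FIXING frame `(T, e)` (`e u = T u T⁻¹`, `e (t₀ z) = t z`): the SAME `(U, H)` serves (★ (G)
  `integral_comp_conj_eq_integral_map_symm_of_signs`); **`…_of_oppositeSigns`** (★ (G′-a) frame), **`…_of_neg`** (`α ↦ −α`).
HONEST LABEL: HC_CM is proved only modulo the printed citations until rung 0 closes; this file proves implications between instances of one named fact and nothing about the fact itself.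

## References
* [Rogawski1990] J. D. Rogawski, *Automorphic Representations of Unitary Groups in Three Variables*, Ann. of Math. Stud. 123 (1990), §8.4 pp. 126–127, §8.2 p. 122.
* [BrockerTomDieck1985] Th. Bröcker, T. tom Dieck, *Representations of Compact Lie Groups*, GTM 98 (1985), IV (3.2).
* [PlatonovRapinchuk1994] V. Platonov, A. Rapinchuk, *Algebraic Groups and Number Theory* (1994), §2.3.
-/

set_option autoImplicit false

noncomputable section

open MeasureTheory Measure Filter Topology NumberField NumberField.InfinitePlace Matrix Equiv
open Literature.NumberTheory.Automorphic Literature.NumberTheory.Automorphic.UnitaryGroup Literature.LinearAlgebra.Matrix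
open scoped MatrixGroups Matrix.Norms.Operator

namespace Literature.NumberTheory.Rogawski1990

/-! ## §1 The prefactor `ρ′Δ` in the angle chart is alternating under `S₃` -/

section Prefactor

/-- Values of a transposition of `Fin 3` at the three points (for `rw`). [cite: BrockerTomDieck1985, IV (3.2)] -/
theorem swap_fin3_apply (a b c : Fin 3) (hca : c ≠ a) (hcb : c ≠ b) :
    Equiv.swap a b a = b ∧ Equiv.swap a b b = a ∧ Equiv.swap a b c = c :=
  ⟨Equiv.swap_apply_left a b, Equiv.swap_apply_right a b, Equiv.swap_apply_of_ne_of_ne hca hcb⟩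

/-- **A transposition flips the sign of the prefactor** `P(z) = z₀z₂⁻¹(1 − z₁z₀⁻¹)(1 − z₂z₁⁻¹)(1 − z₂z₀⁻¹)` (`z_k ≠ 0`). [cite: Rogawski1990, §8.4 p. 126] -/
theorem rhoWeylDelta_angle_comp_swap (z : Fin 3 → ℂ) (hz : ∀ k, z k ≠ 0) (a b : Fin 3) (hab : a ≠ b) :
    z (Equiv.swap a b 0) * (z (Equiv.swap a b 2))⁻¹ *
        ((1 - z (Equiv.swap a b 1) * (z (Equiv.swap a b 0))⁻¹) * (1 - z (Equiv.swap a b 2) * (z (Equiv.swap a b 1))⁻¹) * (1 - z (Equiv.swap a b 2) * (z (Equiv.swap a b 0))⁻¹)) =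
      -(z 0 * (z 2)⁻¹ * ((1 - z 1 * (z 0)⁻¹) * (1 - z 2 * (z 1)⁻¹) * (1 - z 2 * (z 0)⁻¹))) := by
  have h0 := hz 0; have h1 := hz 1; have h2 := hz 2
  fin_cases a <;> fin_cases b
  all_goals first
    | exact absurd rfl hab
    | skip
  · -- swap 0 1
    obtain ⟨e0, e1, e2⟩ := swap_fin3_apply (0 : Fin 3) 1 2 (by decide) (by decide)
    simp only [Fin.zero_eta, Fin.mk_one] at e0 e1 e2 ⊢
    rw [e0, e1, e2]; field_simp; ring
  · -- swap 0 2
    obtain ⟨e0, e2, e1⟩ := swap_fin3_apply (0 : Fin 3) 2 1 (by decide) (by decide)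
    simp only [Fin.zero_eta] at e0 e1 e2 ⊢
    have e2' : Equiv.swap (0 : Fin 3) 2 2 = 0 := e2
    have e1' : Equiv.swap (0 : Fin 3) 2 1 = 1 := e1
    have e0' : Equiv.swap (0 : Fin 3) 2 0 = 2 := e0
    simp only [show ((⟨2, by norm_num⟩ : Fin 3)) = 2 from rfl]
    rw [e0', e1', e2']; field_simp; ring
  · -- swap 1 0
    rw [Equiv.swap_comm]
    obtain ⟨e0, e1, e2⟩ := swap_fin3_apply (0 : Fin 3) 1 2 (by decide) (by decide)
    simp only [Fin.mk_one, Fin.zero_eta]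
    rw [e0, e1, e2]; field_simp; ring
  · -- swap 1 2
    obtain ⟨e1, e2, e0⟩ := swap_fin3_apply (1 : Fin 3) 2 0 (by decide) (by decide)
    simp only [Fin.mk_one, show ((⟨2, by norm_num⟩ : Fin 3)) = 2 from rfl]
    rw [e0, e1, e2]; field_simp; ring
  · -- swap 2 0
    rw [Equiv.swap_comm]
    obtain ⟨e0, e2, e1⟩ := swap_fin3_apply (0 : Fin 3) 2 1 (by decide) (by decide)
    simp only [Fin.zero_eta, show ((⟨2, by norm_num⟩ : Fin 3)) = 2 from rfl]
    rw [e0, e1, e2]; field_simp; ring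
  · -- swap 2 1
    rw [Equiv.swap_comm]
    obtain ⟨e1, e2, e0⟩ := swap_fin3_apply (1 : Fin 3) 2 0 (by decide) (by decide)
    simp only [Fin.mk_one, show ((⟨2, by norm_num⟩ : Fin 3)) = 2 from rfl]
    rw [e0, e1, e2]; field_simp; ring

/-- **THE PREFACTOR IS ALTERNATING**: `P(z ∘ σ) = sign(σ)·P(z)` for every `σ ∈ S₃` and `z_k ≠ 0` (it is `−∏_{i<j}(z_j − z_i)∕(z₀z₁z₂)^{…}`-type: the angle-chart `ρ′Δ` equals
`−∏_{i<j} 2i·sin((θ_j−θ_i)∕2)`). [cite: Rogawski1990, §8.4 p. 126] [cite: BrockerTomDieck1985, IV (3.2)] -/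
theorem rhoWeylDelta_angle_comp_perm (z : Fin 3 → ℂ) (hz : ∀ k, z k ≠ 0) (σ : Perm (Fin 3)) :
    z (σ 0) * (z (σ 2))⁻¹ * ((1 - z (σ 1) * (z (σ 0))⁻¹) * (1 - z (σ 2) * (z (σ 1))⁻¹) * (1 - z (σ 2) * (z (σ 0))⁻¹)) =
      ((Equiv.Perm.sign σ : ℤ) : ℂ) * (z 0 * (z 2)⁻¹ * ((1 - z 1 * (z 0)⁻¹) * (1 - z 2 * (z 1)⁻¹) * (1 - z 2 * (z 0)⁻¹))) := by
  -- induction over transpositions, for all `z` at once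
  revert z
  refine Equiv.Perm.swap_induction_on σ (fun z _ => by simp) (fun f a b hab ih z hz => ?_)
  have hz' : ∀ k, (z ∘ ⇑(Equiv.swap a b)) k ≠ 0 := fun k => hz _
  have step := ih (z ∘ ⇑(Equiv.swap a b)) hz'
  simp only [Function.comp_apply] at step
  simp only [Equiv.Perm.mul_apply]
  rw [step, rhoWeylDelta_angle_comp_swap z hz a b hab, Equiv.Perm.sign_mul, Equiv.Perm.sign_swap hab, Units.val_mul, Units.val_neg, Units.val_one,
    Int.cast_mul, Int.cast_neg, Int.cast_one]
  ring

end Prefactor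

/-! ## §2 Relabelling the frame -/

section OfPerm

variable (L : Type) [Field L] (α : Fin 3 → L) (w : {w : InfinitePlace L // IsComplex w})

/-- **(A6) IS RELABELLING-INVARIANT**: `ArchCentralLimitCornerRegularity L (α ∘ σ) w → ArchCentralLimitCornerRegularity L α w` for every `σ ∈ S₃`.  The corner extension on the chamber
`τ` at the frame `α` is `H(θ) = sign(σ)·H′(θ ∘ σ)`, `H′` the extension on the chamber `σ⁻¹τ` at the frame `α ∘ σ` for the transported data `((e_σ⁻¹)_*ν, Θ ∘ Ad M(σ))`
(★ `ArchLocalRelabelTransport`; §1 for the prefactor). [cite: Rogawski1990, §8.4 p. 126] [cite: BrockerTomDieck1985, IV (3.2)] [cite: PlatonovRapinchuk1994, §2.3] -/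
theorem archCentralLimitCornerRegularity_of_perm (σ : Perm (Fin 3)) (h : ArchCentralLimitCornerRegularity L (α ∘ ⇑σ) w) :
    ArchCentralLimitCornerRegularity L α w := by
  intro _ _ hα hreal ν _ _ Θ hΘ hsupp ζ τ
  -- topology and Borel structure on the relabelled frame `G_w(α ∘ σ)`
  haveI : LocallyCompactSpace (archLocal L 3 (Matrix.diagonal (α ∘ ⇑σ)) w) := locallyCompactSpace_archLocal L 3 (Matrix.diagonal (α ∘ ⇑σ)) w
  haveI : SecondCountableTopology (archLocal L 3 (Matrix.diagonal (α ∘ ⇑σ)) w) := secondCountableTopology_archLocal L 3 (Matrix.diagonal (α ∘ ⇑σ)) w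
  letI : MeasurableSpace (archLocal L 3 (Matrix.diagonal (α ∘ ⇑σ)) w) := borel _
  haveI : BorelSpace (archLocal L 3 (Matrix.diagonal (α ∘ ⇑σ)) w) := ⟨rfl⟩
  -- the pulled-back Haar measure `(e_σ⁻¹)_* ν`
  haveI hH := (ContinuousMulEquiv.restrictSubgroup (GLn.conjEquiv (Matrix.GeneralLinearGroup.mkOfDetNeZero _ (det_monomial_one_ne_zero 3 σ)))
        (archLocal L 3 (Matrix.diagonal (α ∘ ⇑σ)) w) (archLocal L 3 (Matrix.diagonal α) w) (mem_archLocal_comp_perm_iff_conj_mem L 3 α w σ)).symm.isHaarMeasure_map ν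
  haveI hR := isMulRightInvariant_map_relabel_symm L 3 α w σ ν
  have hα' : ∀ i, (α ∘ ⇑σ) i ≠ 0 := fun i => hα (σ i)
  have hreal' : ∀ i, (w.1.embedding ((α ∘ ⇑σ) i)).im = 0 := fun i => hreal (σ i)
  -- (A6) at the relabelled frame, for the transported test function `Θ_σ = Θ ∘ Ad M(σ)` and the chamber `σ⁻¹ τ`
  obtain ⟨U', H', hU', h0', hH', hval'⟩ := h hα' hreal'
    (ν.map (ContinuousMulEquiv.restrictSubgroup (GLn.conjEquiv (Matrix.GeneralLinearGroup.mkOfDetNeZero _ (det_monomial_one_ne_zero 3 σ)))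
        (archLocal L 3 (Matrix.diagonal (α ∘ ⇑σ)) w) (archLocal L 3 (Matrix.diagonal α) w) (mem_archLocal_comp_perm_iff_conj_mem L 3 α w σ)).symm)
    (fun A : Matrix (Fin 3) (Fin 3) ℂ => Θ ((monomial σ fun _ : Fin 3 => (1 : ℂ)) * A *
      (((Matrix.GeneralLinearGroup.mkOfDetNeZero _ (det_monomial_one_ne_zero 3 σ))⁻¹ : GL (Fin 3) ℂ) : Matrix (Fin 3) (Fin 3) ℂ)))
    (contDiff_comp_monomial_conj 3 σ Θ hΘ) (hasCompactSupport_comp_relabel L 3 α w σ Θ hsupp) ζ (σ⁻¹ * τ)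
  -- the relabelling of angle space `θ ↦ θ ∘ σ` is linear, hence smooth
  have hlin : ContDiff ℝ 3 (fun θ : Fin 3 → ℝ => θ ∘ ⇑σ) := contDiff_pi.2 fun i => contDiff_apply ℝ ℝ (σ i)
  refine ⟨(fun θ : Fin 3 → ℝ => θ ∘ ⇑σ) ⁻¹' U', fun θ => ((Equiv.Perm.sign σ : ℤ) : ℂ) * H' (θ ∘ ⇑σ), hU'.preimage hlin.continuous, h0',
    contDiffOn_const.mul (hH'.comp hlin.contDiffOn (Set.mapsTo_preimage _ _)), fun θ hθ hC => ?_⟩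
  have hC' : (θ ∘ ⇑σ) ((σ⁻¹ * τ) 0) < (θ ∘ ⇑σ) ((σ⁻¹ * τ) 1) ∧ (θ ∘ ⇑σ) ((σ⁻¹ * τ) 1) < (θ ∘ ⇑σ) ((σ⁻¹ * τ) 2) := by
    simpa only [Function.comp_apply, Equiv.Perm.mul_apply, Equiv.Perm.coe_inv, Equiv.apply_symm_apply] using hC
  -- `Φ^{α∘σ}_{Θ_σ}(ζe^{i(θ∘σ)}) = Φ^α_Θ(ζe^{iθ})`
  have hback :
      (∫ g' : archLocal L 3 (Matrix.diagonal (α ∘ ⇑σ)) w,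
        Θ ((monomial σ fun _ : Fin 3 => (1 : ℂ)) *
            ((((g' * ⟨circleDiagonal 3 (fun k => ζ * Circle.exp ((θ ∘ ⇑σ) k)), circleDiagonal_mem_archLocal_diagonal L 3 (α ∘ ⇑σ) w _⟩ * g'⁻¹ :
              archLocal L 3 (Matrix.diagonal (α ∘ ⇑σ)) w) : GL (Fin 3) ℂ) : Matrix (Fin 3) (Fin 3) ℂ)) *
          (((Matrix.GeneralLinearGroup.mkOfDetNeZero _ (det_monomial_one_ne_zero 3 σ))⁻¹ : GL (Fin 3) ℂ) : Matrix (Fin 3) (Fin 3) ℂ))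
        ∂(ν.map (ContinuousMulEquiv.restrictSubgroup (GLn.conjEquiv (Matrix.GeneralLinearGroup.mkOfDetNeZero _ (det_monomial_one_ne_zero 3 σ)))
        (archLocal L 3 (Matrix.diagonal (α ∘ ⇑σ)) w) (archLocal L 3 (Matrix.diagonal α) w) (mem_archLocal_comp_perm_iff_conj_mem L 3 α w σ)).symm)) =
      ∫ g : archLocal L 3 (Matrix.diagonal α) w,
        Θ ((((g * ⟨circleDiagonal 3 (fun k => ζ * Circle.exp (θ k)), circleDiagonal_mem_archLocal_diagonal L 3 α w _⟩ * g⁻¹ : archLocal L 3 (Matrix.diagonal α) w) :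
          GL (Fin 3) ℂ) : Matrix (Fin 3) (Fin 3) ℂ)) ∂ν := by
    rw [← integral_comp_conj_circleDiagonal_comp_perm_eq_integral_ambient L 3 α w σ ν Θ (fun k => ζ * Circle.exp ((θ ∘ ⇑σ) k))]
    have hr : (⟨circleDiagonal 3 (fun i => (fun k => ζ * Circle.exp ((θ ∘ ⇑σ) k)) (σ.symm i)),
          circleDiagonal_mem_archLocal_diagonal L 3 α w (fun i => (fun k => ζ * Circle.exp ((θ ∘ ⇑σ) k)) (σ.symm i))⟩ : archLocal L 3 (Matrix.diagonal α) w) =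
        ⟨circleDiagonal 3 (fun k => ζ * Circle.exp (θ k)), circleDiagonal_mem_archLocal_diagonal L 3 α w _⟩ := by
      apply Subtype.ext
      simp only [Function.comp_apply, Equiv.apply_symm_apply]
    rw [hr]
  -- the prefactor at the relabelled angles
  have hP := rhoWeylDelta_angle_comp_perm (fun k => ((ζ * Circle.exp (θ k) : Circle) : ℂ)) (fun k => Circle.coe_ne_zero _) σ
  have hs1 : ((Equiv.Perm.sign σ : ℤ) : ℂ) * ((Equiv.Perm.sign σ : ℤ) : ℂ) = 1 := by
    rw [← Int.cast_mul, ← Units.val_mul, Int.units_mul_self, Units.val_one, Int.cast_one]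
  beta_reduce
  rw [hval' (θ ∘ ⇑σ) hθ hC', hback]
  simp only [Function.comp_apply] at hP ⊢
  rw [hP]
  have key : ∀ P I : ℂ, ((Equiv.Perm.sign σ : ℤ) : ℂ) * (((Equiv.Perm.sign σ : ℤ) : ℂ) * P * I) = P * I := fun P I => by
    calc ((Equiv.Perm.sign σ : ℤ) : ℂ) * (((Equiv.Perm.sign σ : ℤ) : ℂ) * P * I) = (((Equiv.Perm.sign σ : ℤ) : ℂ) * ((Equiv.Perm.sign σ : ℤ) : ℂ)) * (P * I) := by ring
      _ = P * I := by rw [hs1, one_mul]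
  exact key _ _

end OfPerm

/-! ## §3 Torus-fixing frames: opposite sign patterns, `α ↦ −α` -/

section OfFrame

variable (L : Type) [Field L] (α : Fin 3 → L) (w : {w : InfinitePlace L // IsComplex w})
variable (L₀ : Type) [Field L₀] (α₀ : Fin 3 → L₀) (w₀ : {w : InfinitePlace L₀ // IsComplex w})

/-- **(A6) ALONG A TORUS-FIXING FRAME.**  Given `T : GL₃(ℂ)` and `e : U(σ_{w₀} diag α₀)(ℂ) ≃ₜ* U(σ_w diag α)(ℂ)` with `e u = T u T⁻¹` and `e (t₀ z) = t z`, the transfer of `α_i ≠ 0`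
to the source frame and `σ_{w₀}α₀_i` real: `ArchCentralLimitCornerRegularity L₀ α₀ w₀ → ArchCentralLimitCornerRegularity L α w` — the SAME `(U, H)` serves, since
`Φ^α_Θ(t z) = Φ^{α₀}_{Θ∘Ad T}(t₀ z)` (★ (G) `integral_comp_conj_eq_integral_map_symm_of_signs`). [cite: Rogawski1990, §8.4 p. 126] [cite: PlatonovRapinchuk1994, §2.3] -/
theorem archCentralLimitCornerRegularity_of_frame (hreal₀ : ∀ i, (w₀.1.embedding (α₀ i)).im = 0)
    (hα₀ : (∀ i, α i ≠ 0) → ∀ i, α₀ i ≠ 0)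
    (T : GL (Fin 3) ℂ) (e : archLocal L₀ 3 (Matrix.diagonal α₀) w₀ ≃ₜ* archLocal L 3 (Matrix.diagonal α) w)
    (he : ∀ u : archLocal L₀ 3 (Matrix.diagonal α₀) w₀, ((e u : archLocal L 3 (Matrix.diagonal α) w) : GL (Fin 3) ℂ) = T * (u : GL (Fin 3) ℂ) * T⁻¹)
    (hez : ∀ z : Fin 3 → Circle, e ⟨circleDiagonal 3 z, circleDiagonal_mem_archLocal_diagonal L₀ 3 α₀ w₀ z⟩ = ⟨circleDiagonal 3 z, circleDiagonal_mem_archLocal_diagonal L 3 α w z⟩)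
    (h₀ : ArchCentralLimitCornerRegularity L₀ α₀ w₀) : ArchCentralLimitCornerRegularity L α w := by
  intro _ _ hα hreal ν _ _ Θ hΘ hsupp ζ τ
  -- topology and Borel structure on the source frame `G₀`
  haveI : LocallyCompactSpace (archLocal L₀ 3 (Matrix.diagonal α₀) w₀) := locallyCompactSpace_archLocal L₀ 3 (Matrix.diagonal α₀) w₀
  haveI : SecondCountableTopology (archLocal L₀ 3 (Matrix.diagonal α₀) w₀) := secondCountableTopology_archLocal L₀ 3 (Matrix.diagonal α₀) w₀
  letI : MeasurableSpace (archLocal L₀ 3 (Matrix.diagonal α₀) w₀) := borel _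
  haveI : BorelSpace (archLocal L₀ 3 (Matrix.diagonal α₀) w₀) := ⟨rfl⟩
  -- the pulled-back Haar measure
  haveI := isHaarMeasure_map_symm_of_signs L α w L₀ α₀ w₀ e ν
  haveI := isMulRightInvariant_map_symm_of_signs L α w L₀ α₀ w₀ e ν
  -- (A6) at the source frame for `Θ ∘ Ad T`
  obtain ⟨U, H, hU, h0, hH, hval⟩ := h₀ (hα₀ hα) hreal₀ (ν.map e.symm)
    (fun M : Matrix (Fin 3) (Fin 3) ℂ => Θ ((T : Matrix (Fin 3) (Fin 3) ℂ) * M * ((T⁻¹ : GL (Fin 3) ℂ) : Matrix (Fin 3) (Fin 3) ℂ)))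
    (hΘ.comp ((contDiff_const.mul contDiff_id).mul contDiff_const)) (hasCompactSupport_comp_conj_of_signs L α w L₀ α₀ w₀ T e he hsupp) ζ τ
  refine ⟨U, H, hU, h0, hH, fun θ hθ hC => ?_⟩
  rw [hval θ hθ hC, ← integral_comp_conj_eq_integral_map_symm_of_signs L α w L₀ α₀ w₀ T e he hez ν Θ (fun k => ζ * Circle.exp (θ k))]

/-- **(A6) TRANSFERS BETWEEN FRAMES OF OPPOSITE SIGN PATTERNS**: `re σ_w(α_i) · re σ_{w₀}(α₀_i) < 0` for all `i` (`U(σ_w diag α) ≅ U(−σ_{w₀} diag α₀) = U(σ_{w₀} diag α₀)`) ⟹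
`ArchCentralLimitCornerRegularity L₀ α₀ w₀ → ArchCentralLimitCornerRegularity L α w` (§3 frame + ★ (G′-a)). [cite: Rogawski1990, §8.4 p. 126] [cite: PlatonovRapinchuk1994, §2.3] -/
theorem archCentralLimitCornerRegularity_of_oppositeSigns (hreal : ∀ i, (w.1.embedding (α i)).im = 0) (hreal₀ : ∀ i, (w₀.1.embedding (α₀ i)).im = 0)
    (hopp : ∀ i, (w.1.embedding (α i)).re * (w₀.1.embedding (α₀ i)).re < 0)
    (h₀ : ArchCentralLimitCornerRegularity L₀ α₀ w₀) : ArchCentralLimitCornerRegularity L α w := by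
  obtain ⟨T, e, he, hez, -⟩ := exists_continuousMulEquiv_archLocal_of_oppositeSigns L α w L₀ α₀ w₀ hreal hreal₀ hopp
  exact archCentralLimitCornerRegularity_of_frame L α w L₀ α₀ w₀ hreal₀ (fun _ => ne_zero_of_oppositeSigns L α w L₀ α₀ w₀ hopp) T e he hez h₀

/-- **(A6) is insensitive to the global sign of the form**: `ArchCentralLimitCornerRegularity L (−α) w → ArchCentralLimitCornerRegularity L α w` (for `σ_wα_i` real nonzero).
[cite: Rogawski1990, §8.4 p. 126] -/
theorem archCentralLimitCornerRegularity_of_neg (hreal : ∀ i, (w.1.embedding (α i)).im = 0) (hne : ∀ i, (w.1.embedding (α i)).re ≠ 0)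
    (h₀ : ArchCentralLimitCornerRegularity L (fun i => -α i) w) : ArchCentralLimitCornerRegularity L α w := by
  refine archCentralLimitCornerRegularity_of_oppositeSigns L α w L (fun i => -α i) w hreal (fun i => ?_) (fun i => ?_) h₀
  · rw [map_neg, Complex.neg_im, hreal i, neg_zero]
  · rw [map_neg, Complex.neg_re]
    nlinarith [sq_pos_of_ne_zero (hne i)]

end OfFrame

end Literature.NumberTheory.Rogawski1990

end
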